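import Mathlib
import Summits.NavierStokesRegularity.NavierStokesRegularity.Theorems.EulerZoomLiouvillePowerGaugeEulerLiouvilleEnergyVanishing
import HarnessLib

/-!
# BACKWARD ENERGY ESCAPE: a nontrivial member of Seregin's power-gauged class is not tight in the far past
# (crux `EulerZoomLiouville.PowerGaugeEulerLiouville` = stmt-NavierStokesRegularity-19832, lead's line `birth`)

Route `EulerZoomLiouville` (NavierStokesRegularity).  The crux E: an ancient suitable weak Euler flow on
`(−∞,0) × ℝ³` in Seregin's power-gauged class `a^{2ρ} A(a) + a^ρ E(a) + a^{2ρ} D(a) ≤ c` (all `a > 0`)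
vanishes — OPEN on `0 < ρ ≤ 1/2`.  Line `birth`: `stub_largeRho` (landed) → `stub_backwardVanishing`
(landed: every member VANISHES BACKWARD LOCALLY — on each fixed ball, along density-one sets of times) →
`stub_noCollapseFromZero` (OPEN core).  This file composes stub 2 with the stratum «energy-quiescent past»
(`…EnergyVanishing.lean`) and says exactly what separates LOCAL from GLOBAL backward vanishing:

* `ae_eq_zero_of_gauge_of_windowFlux_of_tight` — **class member (`ρ > 0`) + finite WINDOW flux + a far past
  in which the energy distribution is TIGHT (for every `ε > 0` some ball `B(0,R)` and some `N` with
  `∫_{|x| ≥ R} |u(s)|² ≤ ε` for a.e. `s < −N`) ⇒ `u = 0` a.e.**  Proof: stub 2 (`Backward.stub_backwardVanishing`)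
  supplies, arbitrarily far back, positive-measure sets of times at which the energy INSIDE `B(0,R)` is `≤ ε`;
  tightness bounds the energy OUTSIDE; so the past is energy-quiescent and
  `ae_eq_zero_of_gauge_of_windowFlux_of_energyVanishing` applies.
* `powerGaugeEulerLiouville_of_tightPast` — **the crux VERBATIM plus backward tightness, unconditional for
  `2/5 < ρ`.**  CONTRAPOSITIVE (the portrait of a hypothetical counterexample in `2/5 < ρ ≤ 1/2`): a nontrivial
  member's energy ESCAPES TO SPATIAL INFINITY backward in time — for some `ε > 0`, every ball, however large,
  misses energy `> ε` at a non-null set of times in every far past `(−∞,−N)`; at the endpoint `ρ = 1/2` this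
  happens at finite, a.e. non-increasing total energy `≤ c` (`…EnergyMonotone.lean`), exactly as for the
  self-similar candidates `u = (−τ)^{-3/5} V((−τ)^{-2/5} y)`, whose energy `‖V‖₂²` sits at scale `(−τ)^{2/5} → ∞`
  as `τ → −∞`.

WHAT THIS IS NOT: not NS regularity, not the open core (which is precisely about the non-tight members);
a kernel-checked in-window stratum `--supports` stmt-19832. [folklore]
-/

noncomputable section

set_option linter.dupNamespace false

open MeasureTheory Set Filter Topology Metric Function TopologicalSpace
open scoped ENNReal NNReal

namespace Summit.NavierStokesRegularity.NavierStokesRegularity.Theorems.PowerGaugeEulerLiouville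

open Literature.Analysis Literature.Analysis.FunctionSpaces Literature.Analysis.FluidPDE

/-- **A member of the power-gauged class with finite window flux and a backward-tight energy distribution
vanishes.**  Hypotheses: the crux's three (`ρ > 0`), finite window flux `(|u|³+2|p||u|)/max(1,|x|) ∈
L¹((a,b) × ℝ³)` (`a < b < 0`), and TIGHTNESS in the far past: for every `ε > 0` there are `R > 0` and `N` with
`∫_{|x| ≥ R} |u(s)|² ≤ ε` for a.e. `s < −N`.  Stub 2 (local backward vanishing along density-one times) and
tightness make the past energy-quiescent; then `ae_eq_zero_of_gauge_of_windowFlux_of_energyVanishing`.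
[folklore] -/
theorem ae_eq_zero_of_gauge_of_windowFlux_of_tight {ρ : ℝ} (hρ : 0 < ρ)
    {u : ℝ → EuclideanSpace ℝ (Fin 3) → EuclideanSpace ℝ (Fin 3)} {p : ℝ → EuclideanSpace ℝ (Fin 3) → ℝ}
    {H : ℝ → EuclideanSpace ℝ (Fin 3) → EuclideanSpace ℝ (Fin 3) →L[ℝ] EuclideanSpace ℝ (Fin 3)} {c : ℝ≥0}
    (hsw : IsSuitableWeakSolutionOn (slab (EuclideanSpace ℝ (Fin 3)) (Iio 0) isOpen_Iio) 0 0 u p)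
    (hH : HasWeakSpatialGradientOn (slab (EuclideanSpace ℝ (Fin 3)) (Iio 0) isOpen_Iio) u H)
    (hc : ∀ a : ℝ, 0 < a → ENNReal.ofReal (a ^ (2 * ρ)) * cknA a (0 : ℝ × EuclideanSpace ℝ (Fin 3)) u +
        ENNReal.ofReal (a ^ ρ) * cknE a (0 : ℝ × EuclideanSpace ℝ (Fin 3)) H +
        ENNReal.ofReal (a ^ (2 * ρ)) * cknD a (0 : ℝ × EuclideanSpace ℝ (Fin 3)) p ≤ (c : ℝ≥0∞))
    (hwin : ∀ a b : ℝ, a < b → b < 0 → IntegrableOn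
      (fun z : ℝ × EuclideanSpace ℝ (Fin 3) => (‖u z.1 z.2‖ ^ 3 + 2 * |p z.1 z.2| * ‖u z.1 z.2‖) / max 1 ‖z.2‖)
      (Ioo a b ×ˢ (univ : Set (EuclideanSpace ℝ (Fin 3)))) volume)
    (htight : ∀ ε : ℝ, 0 < ε → ∃ R : ℝ, 0 < R ∧ ∃ N : ℝ, ∀ᵐ s ∂(volume : Measure ℝ), s < -N →
      ∫⁻ x in (ball (0 : EuclideanSpace ℝ (Fin 3)) R)ᶜ, ‖u s x‖ₑ ^ 2 ≤ ENNReal.ofReal ε) :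
    uncurry u =ᵐ[volume.restrict (Iio (0 : ℝ) ×ˢ (univ : Set (EuclideanSpace ℝ (Fin 3))))] 0 := by
  refine ae_eq_zero_of_gauge_of_windowFlux_of_energyVanishing hsw hH hc hwin fun ε hε N => ?_
  -- tightness at level `ε/2` beyond the ball `B(0,R)`, for a.e. `s < -N₁`
  obtain ⟨R, hR, N₁, hN₁⟩ := htight (ε / 2) (by positivity)
  -- stub 2: the proportion of times in `(−a²,0)` at which `B(0,R)` holds energy `> ε/2` tends to `0`
  have hvb := Backward.stub_backwardVanishing ρ hρ u p H c ⟨hsw, hH, hc⟩ R (ε / 2) hR (by positivity)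
  set Bad : ℝ → Set ℝ := fun a => {τ : ℝ | τ ∈ Ioo (-(a ^ 2)) 0 ∧
    ENNReal.ofReal (ε / 2) < ∫⁻ y in ball (0 : EuclideanSpace ℝ (Fin 3)) R, ‖u τ y‖ₑ ^ 2} with hBad
  set M : ℝ := max (max N N₁) 0 with hM
  have hMN : N ≤ M := (le_max_left _ _).trans (le_max_left _ _)
  have hMN₁ : N₁ ≤ M := (le_max_right _ _).trans (le_max_left _ _)
  have hM0 : 0 ≤ M := le_max_right _ _
  have hev1 : ∀ᶠ a : ℝ in atTop, volume (Bad a) / ENNReal.ofReal (a ^ 2) < 1 / 2 :=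
    (tendsto_order.1 hvb).2 _ (by norm_num)
  have hev2 : ∀ᶠ a : ℝ in atTop, 2 * M + 2 < a ^ 2 :=
    (tendsto_pow_atTop two_ne_zero).eventually_gt_atTop _
  obtain ⟨a, ha1, ha2, ha0⟩ := (hev1.and (hev2.and (eventually_gt_atTop 0))).exists
  have ha2pos : 0 < a ^ 2 := by positivity
  have hBadlt : volume (Bad a) < 1 / 2 * ENNReal.ofReal (a ^ 2) := by
    rwa [ENNReal.div_lt_iff (Or.inl ((ENNReal.ofReal_pos.2 ha2pos).ne')) (Or.inl ENNReal.ofReal_ne_top)] at ha1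
  -- the candidate set of quiescent times: early, not bad, and outside the null set where tightness fails
  set Tfail : Set ℝ := {s : ℝ | ¬ (s < -N₁ →
    ∫⁻ x in (ball (0 : EuclideanSpace ℝ (Fin 3)) R)ᶜ, ‖u s x‖ₑ ^ 2 ≤ ENNReal.ofReal (ε / 2))} with hTfail
  have hTnull : volume Tfail = 0 := ae_iff.1 hN₁
  set A : Set ℝ := (Ioo (-(a ^ 2)) (-M) \ Bad a) \ Tfail with hAdef
  have hApos : volume A ≠ 0 := by
    intro hA0
    have h0 : volume (Ioo (-(a ^ 2)) (-M) \ Bad a) = 0 := by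
      have h1 := measure_sdiff_null (s := Ioo (-(a ^ 2)) (-M) \ Bad a) hTnull
      rw [← h1]; exact hA0
    have h1 : volume (Ioo (-(a ^ 2)) (-M)) - volume (Bad a) ≤ volume (Ioo (-(a ^ 2)) (-M) \ Bad a) :=
      le_measure_sdiff
    rw [h0, nonpos_iff_eq_zero, tsub_eq_zero_iff_le, Real.volume_Ioo] at h1
    have h2 : ENNReal.ofReal (-M - -(a ^ 2)) < 1 / 2 * ENNReal.ofReal (a ^ 2) := lt_of_le_of_lt h1 hBadlt
    rw [show (1 / 2 : ℝ≥0∞) = ENNReal.ofReal (1 / 2) by rw [ENNReal.ofReal_div_of_pos two_pos]; simp,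
      ← ENNReal.ofReal_mul (by norm_num), ENNReal.ofReal_lt_ofReal_iff (by positivity)] at h2
    linarith
  -- every time in `A` is quiescent at level `ε` and earlier than `-N`
  have hAsub : A ⊆ {s : ℝ | s < -N ∧ ∫⁻ x, ‖u s x‖ₑ ^ 2 ≤ ENNReal.ofReal ε} := by
    intro s hs
    have hsI : s ∈ Ioo (-(a ^ 2)) (-M) := hs.1.1
    have hsBad : s ∉ Bad a := hs.1.2
    have hsT : s ∉ Tfail := hs.2
    have hsN : s < -N := lt_of_lt_of_le hsI.2 (by linarith)
    have hsN₁ : s < -N₁ := lt_of_lt_of_le hsI.2 (by linarith)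
    have hsneg : s < 0 := lt_of_lt_of_le hsI.2 (by linarith)
    have hin : ∫⁻ y in ball (0 : EuclideanSpace ℝ (Fin 3)) R, ‖u s y‖ₑ ^ 2 ≤ ENNReal.ofReal (ε / 2) := by
      by_contra hlt
      exact hsBad ⟨⟨hsI.1, hsneg⟩, not_le.1 hlt⟩
    have hout : ∫⁻ x in (ball (0 : EuclideanSpace ℝ (Fin 3)) R)ᶜ, ‖u s x‖ₑ ^ 2 ≤ ENNReal.ofReal (ε / 2) := by
      have : s < -N₁ → ∫⁻ x in (ball (0 : EuclideanSpace ℝ (Fin 3)) R)ᶜ, ‖u s x‖ₑ ^ 2 ≤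
          ENNReal.ofReal (ε / 2) := by
        simpa only [hTfail, mem_setOf_eq, not_not] using hsT
      exact this hsN₁
    refine ⟨hsN, ?_⟩
    calc ∫⁻ x, ‖u s x‖ₑ ^ 2
        = (∫⁻ x in ball (0 : EuclideanSpace ℝ (Fin 3)) R, ‖u s x‖ₑ ^ 2) +
            ∫⁻ x in (ball (0 : EuclideanSpace ℝ (Fin 3)) R)ᶜ, ‖u s x‖ₑ ^ 2 :=
          (lintegral_add_compl _ measurableSet_ball).symm
      _ ≤ ENNReal.ofReal (ε / 2) + ENNReal.ofReal (ε / 2) := add_le_add hin hout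
      _ = ENNReal.ofReal ε := by
          rw [← ENNReal.ofReal_add (by positivity) (by positivity)]; congr 1; ring
  exact fun h0 => hApos (measure_mono_null hAsub h0)

/-- **No backward-tight nontrivial members, unconditionally for `2/5 < ρ`.**  A member of Seregin's
power-gauged ancient Euler class with `2/5 < ρ` whose energy distribution is tight in the far past (for every
`ε > 0`: `∫_{|x| ≥ R} |u(s)|² ≤ ε` for a.e. `s < −N`, some `R`, `N`) is identically zero — the crux VERBATIM
plus that one hypothesis.  Contrapositive: a NONTRIVIAL member in `2/5 < ρ ≤ 1/2` exhibits BACKWARD ENERGY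
ESCAPE to spatial infinity (at the endpoint `ρ = 1/2`, at finite non-increasing total energy), as the
self-similar collapse candidates do. [folklore] -/
theorem powerGaugeEulerLiouville_of_tightPast :
    ∀ ρ : ℝ, 2 / 5 < ρ → ∀ (u : ℝ → EuclideanSpace ℝ (Fin 3) → EuclideanSpace ℝ (Fin 3))
      (p : ℝ → EuclideanSpace ℝ (Fin 3) → ℝ)
      (H : ℝ → EuclideanSpace ℝ (Fin 3) → EuclideanSpace ℝ (Fin 3) →L[ℝ] EuclideanSpace ℝ (Fin 3)) (c : ℝ≥0),
      IsSuitableWeakSolutionOn (slab (EuclideanSpace ℝ (Fin 3)) (Set.Iio 0) isOpen_Iio) 0 0 u p →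
      HasWeakSpatialGradientOn (slab (EuclideanSpace ℝ (Fin 3)) (Set.Iio 0) isOpen_Iio) u H →
      (∀ a : ℝ, 0 < a → ENNReal.ofReal (a ^ (2 * ρ)) * cknA a (0 : ℝ × EuclideanSpace ℝ (Fin 3)) u +
        ENNReal.ofReal (a ^ ρ) * cknE a (0 : ℝ × EuclideanSpace ℝ (Fin 3)) H +
        ENNReal.ofReal (a ^ (2 * ρ)) * cknD a (0 : ℝ × EuclideanSpace ℝ (Fin 3)) p ≤ (c : ℝ≥0∞)) →
      (∀ ε : ℝ, 0 < ε → ∃ R : ℝ, 0 < R ∧ ∃ N : ℝ, ∀ᵐ s ∂(volume : Measure ℝ), s < -N →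
        ∫⁻ x in (ball (0 : EuclideanSpace ℝ (Fin 3)) R)ᶜ, ‖u s x‖ₑ ^ 2 ≤ ENNReal.ofReal ε) →
      Function.uncurry u =ᵐ[volume.restrict (Set.Iio (0 : ℝ) ×ˢ (Set.univ : Set (EuclideanSpace ℝ (Fin 3))))] 0 :=
  fun _ hρ _ _ _ _ hsw hH hc htight =>
    ae_eq_zero_of_gauge_of_windowFlux_of_tight (by linarith) hsw hH hc
      (fun _ _ hab hb => windowFlux_integrableOn_of_gauge hρ hsw hH hc hab hb) htight

end Summit.NavierStokesRegularity.NavierStokesRegularity.Theorems.PowerGaugeEulerLiouville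

end
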